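import Literature.Probability.RandomPlanarGeometry.HexSAWBrickWallStripFugacityTwoSided
import Literature.Probability.RandomPlanarGeometry.HexSAWBrickWallStripFugacityLevel0Zero
import HarnessLib

/-!
# Two attractive walls: `μ_T(y,z)² ≤ max(y,z) · μ(S_T)²`, so `√y < μ_T(y,y) ≤ √y · μ(S_T) ≤ √y · μ` (`T ≥ 1`, `y, z ≥ 1`)

Topic `Literature/Probability/RandomPlanarGeometry` (lane «pcv-sawmu»; the upper companion of `HexSAWBrickWallStripFugacityTwoWallSwitch.lean`'s
`√y < μ_T(y,y)`; continues `HexSAWBrickWallStripFugacityTwoSided.lean` (`HexBW.stripZ₂`, `HexBW.stripMuY₂`, `HexBW.tendsto_stripZ₂_rpow`) and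
`HexSAWBrickWallStrip.lean` (`HexBW.stripCount T N = c_N(S_T)`, `HexBW.stripConnectiveConstant T = μ(S_T)`, `HexBW.tendsto_stripCount_rpow`,
`HexBW.stripConnectiveConstant_le : μ(S_T) ≤ μ`)).

Source frame: N. R. Beaton, M. Bousquet-Mélou, J. de Gier, H. Duminil-Copin, A. J. Guttmann, CMP 326 (2014) = arXiv:1109.0358v5, §3.2 (p. 10:
`C_{T,k}(y,z)`, Proposition 6) and §3.1 Proposition 5 with the remark after it (arXiv v5 p. 9 l. 16, p. 10 ll. 2–3: `μ(y) ≥ √y`; "`μ(y) ∼ √y` in our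
honeycomb setting") — the UPPER bound `μ(y) ≤ √y·μ` is NOT printed there: it is the tree's lane lemma `Wall.surfaceMu_le_sqrt_mul`
(`HexSAWSurfaceYcProp5Riders.lean` §A: surface vertices occur at even times only), here transferred to two weighted walls;
I. G. Enting, I. Jensen, LNP 775 §7.4.2 Fig. 7.10 (brickwork lattice); N. Madras, G. Slade (1993) §8.2.

## What is proved (namespace `…SAW.HexBW`, `T ≥ 1`)

In the brick-wall strip `S_T` NO TWO CONSECUTIVE vertices of a walk are weighted (bottom-weighted = row `0`, odd `x`; top-weighted = row `T`,
`x + T` even): a horizontal step changes the parity of `x`, and a vertical bond `{(x,r),(x,r+1)}` (present iff `x + r` even) has its lower end at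
even `x + r` (not bottom-weighted if `r = 0`) and its upper end at odd `x + (r+1)` (not top-weighted if `r + 1 = T`).  Hence

* `wIndic_add_succ_le_one`: consecutive weight indicators sum to `≤ 1`; `bottomVisits₀_add_topVisits₀_le : bc + tc ≤ N/2 + 1`;
* `stripZ₂_le_pow_mul_stripCount : C_{T,N}(y,z) ≤ max(y,z)^{N/2+1} · c_N(S_T)` (`y, z ≥ 1`);
* **`stripMuY₂_sq_le : μ_T(y,z)² ≤ max(y,z) · μ(S_T)²`**, **`stripMuY₂_le_sqrt_mul : μ_T(y,z) ≤ √(max(y,z)) · μ(S_T)`**, and with `μ(S_T) ≤ μ`: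
  `stripMuY₂_le_sqrt_mul_hexConnectiveConstant : μ_T(y,z) ≤ √(max(y,z)) · μ`.

With `HexBW.sqrt_lt_stripMuY₂_self` (tree): `1 < μ_T(y,y)/√y ≤ μ(S_T) < μ = 1.8477…` at every width `T ≥ 1` — the two-wall rate is `Θ(√y)`.
Label (author's proposal): LANE LEMMA XS–S, the two-wall strip version of the TREE's parity bound `Wall.surfaceMu_le_sqrt_mul` (not of a
printed statement); elementary.  EDITIONS: ed.1 af411fcc92b94281; ed.2 (this) = ed.1 + token TU-1 (lit-1 g19: attribution of the `√y·μ` bound to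
the tree, five docstring places) — DOCSTRING-ONLY.
-/

noncomputable section

open Finset Filter Topology Literature.Probability.LatticeModels Literature.Probability.Percolation SimpleGraph

namespace Literature.Probability.RandomPlanarGeometry.SAW.HexBW

variable {y z : ℝ} {T N : ℕ} {p : Site 2 × (ℕ → Site 2)}

/-- The weight indicator of the `m`-th vertex of a placed walk: `[bottom-weighted] + [top-weighted]`. [cite: BeatonBousquetMelouDeGierDuminilCopinGuttmann2014, §3.2 (arXiv v5 p. 10: bc(ω), tc(ω))] -/
def wIndic (T : ℕ) (a : Site 2) (υ : ℕ → Site 2) (m : ℕ) : ℕ :=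
  (if (a + υ m) 1 = 0 ∧ (a + υ m) 0 % 2 = 1 then 1 else 0) + (if (a + υ m) 1 = (T : ℤ) ∧ ((a + υ m) 0 + T) % 2 = 0 then 1 else 0)

/-- `bc + tc` is the sum of the weight indicators. [cite: BeatonBousquetMelouDeGierDuminilCopinGuttmann2014, §3.2 (arXiv v5 p. 10)] -/
theorem bottomVisits₀_add_topVisits₀_eq_sum (T : ℕ) (a : Site 2) (υ : ℕ → Site 2) (N : ℕ) :
    bottomVisits₀ a υ N + topVisits₀ T a υ N = ∑ m ∈ range (N + 1), wIndic T a υ m := by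
  unfold bottomVisits₀ topVisits₀ wIndic
  exact Finset.sum_add_distrib.symm

/-- A single vertex carries at most one weight (`T ≥ 1`: the walls are distinct rows). [cite: BeatonBousquetMelouDeGierDuminilCopinGuttmann2014, §3.2 (arXiv v5 p. 10)] -/
theorem wIndic_le_one (hT : 1 ≤ T) (a : Site 2) (υ : ℕ → Site 2) (m : ℕ) : wIndic T a υ m ≤ 1 := by
  unfold wIndic
  have hT' : (0 : ℤ) < (T : ℤ) := by exact_mod_cast hT
  split_ifs <;> omega

/-- **No two consecutive vertices of a walk of `S_T` are weighted** (`T ≥ 1`). [cite: EntingJensen2009, §7.4.2, Fig. 7.10 (vertical bonds {(x,y),(x,y+1)} with x+y even); BeatonBousquetMelouDeGierDuminilCopinGuttmann2014, §3.1 Proposition 5 (arXiv v5 p. 9 l. 16: μ(y) ≥ √y — the upper bound √y·μ is the tree's `Wall.surfaceMu_le_sqrt_mul`, surface vertices at even times, here for two walls)] -/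
theorem wIndic_add_succ_le_one (hT : 1 ≤ T) (hp : p ∈ stripPairs T N) {m : ℕ} (hm : m < N) :
    wIndic T p.1 p.2 m + wIndic T p.1 p.2 (m + 1) ≤ 1 := by
  obtain ⟨-, -, hbw, hin⟩ := mem_stripPairs.1 hp
  have hadj := hbw m hm
  rw [brickWallGraph_adj_coord] at hadj
  have h0 := hin m hm.le
  have h1 := hin (m + 1) hm
  unfold InStrip at h0 h1
  unfold wIndic
  simp only [Pi.add_apply] at hadj h0 h1 ⊢
  have hT' : (1 : ℤ) ≤ (T : ℤ) := by exact_mod_cast hT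
  split_ifs <;> omega

/-- Sums of a `{0,1}`-sequence with no two consecutive ones: `Σ_{m ≤ n} f(m) ≤ n/2 + 1`. [cite: MadrasSlade1993, §1.2 (elementary counting)] -/
private theorem sum_le_half_add_one (f : ℕ → ℕ) (N : ℕ) (h1 : ∀ m, m ≤ N → f m ≤ 1)
    (h2 : ∀ m, m < N → f m + f (m + 1) ≤ 1) : ∀ n, n ≤ N → ∑ m ∈ range (n + 1), f m ≤ n / 2 + 1 := by
  intro n
  induction n using Nat.strong_induction_on with
  | _ n ih =>
    intro hn
    rcases n with _ | _ | n
    · simpa using h1 0 hn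
    · rw [Finset.sum_range_succ, Finset.sum_range_succ, Finset.sum_range_zero, zero_add]
      have := h2 0 (by omega)
      omega
    · rw [Finset.sum_range_succ, Finset.sum_range_succ]
      have ha := ih n (by omega) (by omega)
      have hb : f (n + 1) + f (n + 2) ≤ 1 := h2 (n + 1) (by omega)
      have e : (n + 2) / 2 + 1 = n / 2 + 1 + 1 := by omega
      rw [e]
      omega

/-- **`bc + tc ≤ N/2 + 1`** for every walk of `S_N(S_T)` (`T ≥ 1`). [cite: BeatonBousquetMelouDeGierDuminilCopinGuttmann2014, §3.2 (arXiv v5 p. 10: bc(ω), tc(ω)); the parity count is the tree's `Wall.surfaceMu_le_sqrt_mul` device transferred] -/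
theorem bottomVisits₀_add_topVisits₀_le (hT : 1 ≤ T) (hp : p ∈ stripPairs T N) :
    bottomVisits₀ p.1 p.2 N + topVisits₀ T p.1 p.2 N ≤ N / 2 + 1 := by
  rw [bottomVisits₀_add_topVisits₀_eq_sum]
  exact sum_le_half_add_one _ N (fun m _ => wIndic_le_one hT _ _ m) (fun m hm => wIndic_add_succ_le_one hT hp hm) N le_rfl

/-- **`C_{T,N}(y,z) ≤ max(y,z)^{N/2+1} · c_N(S_T)`** (`T ≥ 1`, `y, z ≥ 1`). [cite: BeatonBousquetMelouDeGierDuminilCopinGuttmann2014, §3.2 (arXiv v5 p. 10: C_{T,k}(y,z)); MadrasSlade1993, §8.2] -/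
theorem stripZ₂_le_pow_mul_stripCount (hT : 1 ≤ T) (hy : 1 ≤ y) (hz : 1 ≤ z) (N : ℕ) :
    stripZ₂ T N y z ≤ (max y z) ^ (N / 2 + 1) * stripCount T N := by
  set M := max y z with hM
  have hM1 : 1 ≤ M := le_trans hy (le_max_left _ _)
  have hterm : ∀ p ∈ stripPairs T N, y ^ bottomVisits₀ p.1 p.2 N * z ^ topVisits₀ T p.1 p.2 N ≤ M ^ (N / 2 + 1) := by
    intro p hp
    calc y ^ bottomVisits₀ p.1 p.2 N * z ^ topVisits₀ T p.1 p.2 N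
        ≤ M ^ bottomVisits₀ p.1 p.2 N * M ^ topVisits₀ T p.1 p.2 N :=
          mul_le_mul (pow_le_pow_left₀ (by linarith) (le_max_left _ _) _) (pow_le_pow_left₀ (by linarith) (le_max_right _ _) _)
            (by positivity) (by positivity)
      _ = M ^ (bottomVisits₀ p.1 p.2 N + topVisits₀ T p.1 p.2 N) := (pow_add _ _ _).symm
      _ ≤ M ^ (N / 2 + 1) := pow_le_pow_right₀ hM1 (bottomVisits₀_add_topVisits₀_le hT hp)
  calc stripZ₂ T N y z = ∑ p ∈ stripPairs T N, y ^ bottomVisits₀ p.1 p.2 N * z ^ topVisits₀ T p.1 p.2 N := rfl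
    _ ≤ ∑ p ∈ stripPairs T N, M ^ (N / 2 + 1) := Finset.sum_le_sum hterm
    _ = (max y z) ^ (N / 2 + 1) * stripCount T N := by rw [Finset.sum_const, nsmul_eq_mul, mul_comm, stripCount, hM]

/-- `(x^r)² = (x²)^r` for `x ≥ 0`. [cite: MadrasSlade1993, §1.2 (elementary)] -/
private theorem rpow_sq_comm {x : ℝ} (hx : 0 ≤ x) (r : ℝ) : (x ^ r) ^ 2 = (x ^ 2) ^ r := by
  rw [← Real.rpow_natCast (x ^ r) 2, ← Real.rpow_mul hx, ← Real.rpow_natCast x 2, ← Real.rpow_mul hx, mul_comm]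

/-- **`μ_T(y,z)² ≤ max(y,z) · μ(S_T)²`** (`T ≥ 1`, `y, z ≥ 1`): Fekete limits of `C_{T,N}(y,z)^{2/N} ≤ max(y,z)^{1+2/N}·… ≤ max(y,z)·(max(y,z)²)^{1/N}·c_N(S_T)^{2/N}`.
[cite: BeatonBousquetMelouDeGierDuminilCopinGuttmann2014, §3.2 Proposition 6 (arXiv v5 p. 10: μ_T(y,z)) and §3.1 Proposition 5 with the remark after it (p. 9 l. 16, p. 10 ll. 2–3: μ(y) ≥ √y, "μ(y) ∼ √y"); the upper bound μ(y) ≤ √y·μ is the tree's `Wall.surfaceMu_le_sqrt_mul`, here transferred to two walls] -/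
theorem stripMuY₂_sq_le (hT : 1 ≤ T) (hy : 1 ≤ y) (hz : 1 ≤ z) :
    stripMuY₂ T y z ^ 2 ≤ max y z * stripConnectiveConstant T ^ 2 := by
  have hy0 : 0 < y := by linarith
  have hz0 : 0 < z := by linarith
  set M := max y z with hM
  have hM1 : 1 ≤ M := le_trans hy (le_max_left _ _)
  have hM0 : 0 < M := by linarith
  -- left: `(Z_N^{1/N})² → μ_T²`
  have hL : Tendsto (fun n : ℕ => (stripZ₂ T n y z ^ (1 / (n : ℝ))) ^ 2) atTop (𝓝 (stripMuY₂ T y z ^ 2)) :=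
    (tendsto_stripZ₂_rpow T hy0 hz0).pow 2
  -- right: `M · (M²)^{1/N} · (c_N^{1/N})² → M · 1 · μ(S_T)²`
  have hR : Tendsto (fun n : ℕ => M * (M ^ 2) ^ (1 / (n : ℝ)) * ((stripCount T n : ℝ) ^ (1 / (n : ℝ))) ^ 2) atTop
      (𝓝 (M * 1 * stripConnectiveConstant T ^ 2)) :=
    ((tendsto_const_nhds.mul (tendsto_const_rpow_one_div_nat₀ (by positivity))).mul ((tendsto_stripCount_rpow T).pow 2))
  rw [mul_one] at hR
  refine le_of_tendsto_of_tendsto' hL hR fun n => ?_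
  -- pointwise: `(Z_n^{1/n})² ≤ M (M²)^{1/n} (c_n^{1/n})²`
  rcases Nat.eq_zero_or_pos n with rfl | hn
  · simp only [Nat.cast_zero, div_zero, Real.rpow_zero, one_pow, mul_one]
    exact hM1
  have hn0 : (0 : ℝ) < n := by exact_mod_cast hn
  have hZ0 : 0 ≤ stripZ₂ T n y z := (stripZ₂_pos T n hy0 hz0).le
  have hc0 : (0 : ℝ) ≤ stripCount T n := by positivity
  have hbound : stripZ₂ T n y z ^ 2 ≤ M ^ n * M ^ 2 * (stripCount T n : ℝ) ^ 2 := by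
    have h := stripZ₂_le_pow_mul_stripCount hT hy hz n
    rw [← hM] at h
    have h2 : (M ^ (n / 2 + 1)) ^ 2 ≤ M ^ n * M ^ 2 := by
      rw [← pow_mul, ← pow_add]
      exact pow_le_pow_right₀ hM1 (by omega)
    calc stripZ₂ T n y z ^ 2 ≤ (M ^ (n / 2 + 1) * stripCount T n) ^ 2 := pow_le_pow_left₀ hZ0 h 2
      _ = (M ^ (n / 2 + 1)) ^ 2 * (stripCount T n : ℝ) ^ 2 := mul_pow _ _ _
      _ ≤ M ^ n * M ^ 2 * (stripCount T n : ℝ) ^ 2 := mul_le_mul_of_nonneg_right h2 (by positivity)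
  -- take `1/n`-th powers
  have e1 : (stripZ₂ T n y z ^ (1 / (n : ℝ))) ^ 2 = (stripZ₂ T n y z ^ 2) ^ (1 / (n : ℝ)) := rpow_sq_comm hZ0 _
  have e3 : (M ^ n) ^ (1 / (n : ℝ)) = M := by rw [one_div]; exact Real.pow_rpow_inv_natCast hM0.le hn.ne'
  have e2 : M * (M ^ 2) ^ (1 / (n : ℝ)) * ((stripCount T n : ℝ) ^ (1 / (n : ℝ))) ^ 2 =
      (M ^ n * M ^ 2 * (stripCount T n : ℝ) ^ 2) ^ (1 / (n : ℝ)) := by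
    rw [rpow_sq_comm hc0, Real.mul_rpow (by positivity) (by positivity), Real.mul_rpow (by positivity) (by positivity), e3]
  rw [e1, e2]
  exact Real.rpow_le_rpow (by positivity) hbound (by positivity)

/-- **`μ_T(y,z) ≤ √(max(y,z)) · μ(S_T)`** (`T ≥ 1`, `y, z ≥ 1`). [cite: BeatonBousquetMelouDeGierDuminilCopinGuttmann2014, §3.2 Proposition 6 (arXiv v5 p. 10) and §3.1 Proposition 5 (p. 9 l. 16: μ(y) ≥ √y); upper side = the tree's `Wall.surfaceMu_le_sqrt_mul` transferred] -/
theorem stripMuY₂_le_sqrt_mul (hT : 1 ≤ T) (hy : 1 ≤ y) (hz : 1 ≤ z) :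
    stripMuY₂ T y z ≤ Real.sqrt (max y z) * stripConnectiveConstant T := by
  have hy0 : 0 < y := by linarith
  have hz0 : 0 < z := by linarith
  have hμ : 0 ≤ stripMuY₂ T y z := (stripMuY₂_pos T hy0 hz0).le
  have hS := (stripConnectiveConstant_pos T).le
  have hM : 0 ≤ max y z := le_trans hy0.le (le_max_left _ _)
  have h := stripMuY₂_sq_le hT hy hz
  have e : (Real.sqrt (max y z) * stripConnectiveConstant T) ^ 2 = max y z * stripConnectiveConstant T ^ 2 := by
    rw [mul_pow, Real.sq_sqrt hM]
  have h2 : stripMuY₂ T y z ^ 2 ≤ (Real.sqrt (max y z) * stripConnectiveConstant T) ^ 2 := by rw [e]; exact h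
  exact (pow_le_pow_iff_left₀ hμ (by positivity) two_ne_zero).1 h2

/-- **`μ_T(y,z) ≤ √(max(y,z)) · μ`** (`T ≥ 1`, `y, z ≥ 1`; `μ(S_T) ≤ μ`). [cite: BeatonBousquetMelouDeGierDuminilCopinGuttmann2014, §3.2 Proposition 6 (arXiv v5 p. 10) and §3.1 Proposition 5 (p. 9 l. 16: μ(y) ≥ √y; the bound √y·μ is the tree's `Wall.surfaceMu_le_sqrt_mul`); MadrasSlade1993, §8.2 (μ(S_T) ≤ μ)] -/
theorem stripMuY₂_le_sqrt_mul_hexConnectiveConstant (hT : 1 ≤ T) (hy : 1 ≤ y) (hz : 1 ≤ z) :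
    stripMuY₂ T y z ≤ Real.sqrt (max y z) * hexConnectiveConstant :=
  (stripMuY₂_le_sqrt_mul hT hy hz).trans
    (mul_le_mul_of_nonneg_left (stripConnectiveConstant_le T) (Real.sqrt_nonneg _))

/-- On the diagonal: **`μ_T(y,y) ≤ √y · μ(S_T)`** (`T ≥ 1`, `y ≥ 1`). [cite: BeatonBousquetMelouDeGierDuminilCopinGuttmann2014, §3.2 Proposition 6 (arXiv v5 p. 10) and §3.1 Proposition 5 (p. 9 l. 16: μ(y) ≥ √y; upper side = the tree's `Wall.surfaceMu_le_sqrt_mul` transferred)] -/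
theorem stripMuY₂_self_le_sqrt_mul (hT : 1 ≤ T) (hy : 1 ≤ y) :
    stripMuY₂ T y y ≤ Real.sqrt y * stripConnectiveConstant T := by
  simpa only [max_self] using stripMuY₂_le_sqrt_mul hT hy hy

end Literature.Probability.RandomPlanarGeometry.SAW.HexBW
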